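import Mathlib
import HarnessLib
import Summits.HubbardSuperconductivity.HubbardSuperconductivity.Theorems.KLProgrammeC4aBubbleTubeRep
import Summits.HubbardSuperconductivity.HubbardSuperconductivity.Theorems.KLProgrammeC4aPartnerBandTangencyDefect
import Summits.HubbardSuperconductivity.HubbardSuperconductivity.Theorems.KLProgrammeC4aJacobianFrameJets
import Summits.HubbardSuperconductivity.HubbardSuperconductivity.Theorems.KLProgrammeC4aValueBridgeGeometry

/-!
# Route `KLProgramme` — crux C4a, S3 brick (B3, DIFFERENTIATION UNDER THE LOOP INTEGRAL, order 1): the loop-angle integral of the co-moving bubble is differentiable in the base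
# angle, with derivative the integral of `∂J·Ψ(ē) + J·𝒜·Ψ′(ē)`

Cell `gate-hubbard-kl`, lane hubbard-kl-c4a-1 (g6); helper for stub (C) `stub_twoLeg_curvature` of the engine-flow child `KLRegimeEngineV17F2`
(stmt-HubbardSuperconductivity-20437); memo HOME/hubbard-kl-c4a-1/C4A-PLAN.md §24.4, §24.9 ((B3) step (iii) at i = 1).  After `…C4aBubbleTubeRep`, the tube piece of the co-moving
bubble is `∫ f(e)·I(e;θ) de` with the loop-angle integral `I(e;θ) = ∫_{(−π,π)} J(e,φ+θ)·Ψ(ē(e,φ;θ)) dφ`, `ē = e_K(Φ(0,θ) + Φ(ρ′,ϑ′+θ) − Φ(e,φ+θ))`.  Here: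
dominated differentiation in `θ` (Mathlib `hasDerivAt_integral_of_dominated_loc_of_deriv_le`, constant dominator on the finite loop circle):

* `hasDerivAt_setIntegral_smul_comp` — the carrier-free statement for `θ ↦ ∫_{(−π,π)} J(φ+θ)·Ψ(E(θ,φ)) dφ` given derivative data and uniform bounds for `J, Ψ, E`;
* `contDiff_levelChartJac_angle`, `hasDerivAt_partnerBand_pp_base` (the base-angle derivative of the partner band = the anisotropy defect
  `𝒜 = De_K(S − Φ(e,φ+θ))[∂_sΦ(0,θ) + ∂_sΦ(ρ′,ϑ′+θ) − ∂_sΦ(e,φ+θ)]`, all loop variables fixed), `abs_anisotropy_pp_le` (`|𝒜| ≤ 3K₁D₁`);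
* **`hasDerivAt_loopIntegral_pp`** — `∂_θ I(e;θ) = ∫ [J(e,φ+θ)·𝒜·Ψ′(ē) + ∂_sJ(e,φ+θ)·Ψ(ē)] dφ` for every smooth bounded `Ψ` with bounded derivative.

The n-free estimates of these derivatives are (B4); here only legality (the dominator is `klJacG₁·M₀ + klJacG₀·3K₁D₁·M₁`).  Measure-theoretic bookkeeping on landed objects; nothing about
the model's sizes; nothing asserts superconductivity.  References: FST II CPAM 51 (1998) §3; BGM 2006 §2.4 (2.40) [cite: BenfattoGiulianiMastropietro2006].
-/

noncomputable section

namespace Summit.HubbardSuperconductivity.HubbardSuperconductivity.Theorems.C4a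

set_option linter.dupNamespace false -- summit = problem name (single-conjunct summit), D-0017

open Real Set Filter MeasureTheory Metric
open scoped Topology ContDiff
open Literature.MathematicalPhysics.QuantumLattice Literature.MathematicalPhysics.QuantumLattice.BandSectorCounting Literature.Probability.LatticeModels
open Summit.HubbardSuperconductivity.HubbardSuperconductivity.Theorems.KLRegimeSplit
open Summit.HubbardSuperconductivity.HubbardSuperconductivity.Theorems.DispersionFlow
open Summit.HubbardSuperconductivity.HubbardSuperconductivity.Theorems.PerturbedFermiCurve

/-! ## §1 The carrier-free dominated differentiation -/

section Abstract

/-- **Differentiation under the loop integral** (carrier-free): with `J′` the derivative of `J`, `Ψ′` of `Ψ`, `E′(θ,φ)` the `θ`-derivative of `E(·,φ)`, all continuous and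
uniformly bounded, `θ ↦ ∫_{(−π,π)} J(φ+θ)·Ψ(E(θ,φ)) dφ` has derivative `∫_{(−π,π)} [J(φ+θ)·(E′(θ,φ)·Ψ′(E(θ,φ))) + J′(φ+θ)·Ψ(E(θ,φ))] dφ`. [folklore] -/
theorem hasDerivAt_setIntegral_smul_comp {J J' : ℝ → ℝ} {Ψ Ψ' : ℝ → ℂ} {E E' : ℝ → ℝ → ℝ} {J₀ J₁ M₀ M₁ MA : ℝ}
    (hJ : ∀ s, HasDerivAt J (J' s) s) (hJ'c : Continuous J') (hJ0 : ∀ s, |J s| ≤ J₀) (hJ1 : ∀ s, |J' s| ≤ J₁)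
    (hΨ : ∀ x, HasDerivAt Ψ (Ψ' x) x) (hΨ'c : Continuous Ψ') (hΨ0 : ∀ x, ‖Ψ x‖ ≤ M₀) (hΨ1 : ∀ x, ‖Ψ' x‖ ≤ M₁)
    (hE : ∀ θ φ, HasDerivAt (fun ψ : ℝ => E ψ φ) (E' θ φ) θ) (hEc : ∀ θ, Continuous fun φ : ℝ => E θ φ) (hE'c : ∀ θ, Continuous fun φ : ℝ => E' θ φ)
    (hE1 : ∀ θ φ, |E' θ φ| ≤ MA) (θ₀ : ℝ) :
    HasDerivAt (fun θ : ℝ => ∫ φ in Ioo (-π) π, (J (φ + θ) : ℝ) • Ψ (E θ φ))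
      (∫ φ in Ioo (-π) π, ((J (φ + θ₀) : ℝ) • ((E' θ₀ φ) • Ψ' (E θ₀ φ)) + (J' (φ + θ₀)) • Ψ (E θ₀ φ))) θ₀ := by
  have hJc : Continuous J := continuous_iff_continuousAt.2 fun s => (hJ s).continuousAt
  have hΨc : Continuous Ψ := continuous_iff_continuousAt.2 fun x => (hΨ x).continuousAt
  -- continuity of the integrand and of its derivative in the loop angle
  have hFc : ∀ θ, Continuous fun φ : ℝ => (J (φ + θ) : ℝ) • Ψ (E θ φ) := fun θ =>
    (hJc.comp (continuous_id.add continuous_const)).smul (hΨc.comp (hEc θ))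
  have hF'c : ∀ θ, Continuous fun φ : ℝ => (J (φ + θ) : ℝ) • ((E' θ φ) • Ψ' (E θ φ)) + (J' (φ + θ)) • Ψ (E θ φ) := fun θ =>
    ((hJc.comp (continuous_id.add continuous_const)).smul ((hE'c θ).smul (hΨ'c.comp (hEc θ)))).add
      ((hJ'c.comp (continuous_id.add continuous_const)).smul (hΨc.comp (hEc θ)))
  -- the pointwise derivative
  have hdiff : ∀ φ θ, HasDerivAt (fun ψ : ℝ => (J (φ + ψ) : ℝ) • Ψ (E ψ φ))
      ((J (φ + θ) : ℝ) • ((E' θ φ) • Ψ' (E θ φ)) + (J' (φ + θ)) • Ψ (E θ φ)) θ := fun φ θ => by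
    have h1 : HasDerivAt (fun ψ : ℝ => J (φ + ψ)) (J' (φ + θ)) θ := HasDerivAt.comp_const_add φ θ (hJ (φ + θ))
    have h2 : HasDerivAt (fun ψ : ℝ => Ψ (E ψ φ)) ((E' θ φ) • Ψ' (E θ φ)) θ := (hΨ (E θ φ)).scomp θ (hE θ φ)
    exact h1.smul h2
  -- the uniform bound
  have hJ00 : 0 ≤ J₀ := (abs_nonneg _).trans (hJ0 0)
  have hJ10 : 0 ≤ J₁ := (abs_nonneg _).trans (hJ1 0)
  have hM10 : 0 ≤ M₁ := (norm_nonneg _).trans (hΨ1 0)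
  have hbound : ∀ φ θ, ‖(J (φ + θ) : ℝ) • ((E' θ φ) • Ψ' (E θ φ)) + (J' (φ + θ)) • Ψ (E θ φ)‖ ≤ J₀ * (MA * M₁) + J₁ * M₀ := fun φ θ => by
    refine (norm_add_le _ _).trans (add_le_add ?_ ?_)
    · rw [norm_smul, norm_smul, Real.norm_eq_abs, Real.norm_eq_abs]
      have hMA0 : 0 ≤ MA := (abs_nonneg _).trans (hE1 θ φ)
      gcongr
      · exact hJ0 _
      · exact hE1 _ _
      · exact hΨ1 _
    · rw [norm_smul, Real.norm_eq_abs]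
      have := hJ1 (φ + θ); have := hΨ0 (E θ φ); have := abs_nonneg (J' (φ + θ))
      gcongr
  have hres := hasDerivAt_integral_of_dominated_loc_of_deriv_le (μ := volume.restrict (Ioo (-π) π)) (x₀ := θ₀)
    (F := fun θ φ => (J (φ + θ) : ℝ) • Ψ (E θ φ)) (F' := fun θ φ => (J (φ + θ) : ℝ) • ((E' θ φ) • Ψ' (E θ φ)) + (J' (φ + θ)) • Ψ (E θ φ))
    (bound := fun _ => J₀ * (MA * M₁) + J₁ * M₀) univ_mem
    (Eventually.of_forall fun θ => (hFc θ).aestronglyMeasurable)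
    (((hFc θ₀).integrableOn_Icc (a := -π) (b := π)).mono_set Ioo_subset_Icc_self) (hF'c θ₀).aestronglyMeasurable
    (Eventually.of_forall fun φ θ _ => hbound φ θ)
    ((continuous_const.integrableOn_Icc (a := -π) (b := π)).mono_set Ioo_subset_Icc_self)
    (Eventually.of_forall fun φ θ _ => hdiff φ θ)
  exact hres.2

end Abstract

/-! ## §2 The co-moving pp loop integral -/

section Rep

variable {a b : ℝ} (B : BandBounds a b) {K : TrigPolyC4v} {A : ℝ}
  (hA : ∀ p : Momentum, ∀ j ≤ 2, ‖iteratedFDeriv ℝ j (frameShift K) p‖ ≤ A) (hADt : 2 * A < B.Dtmin)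
  {μ r : ℝ} (hlo : a < μ - r - A) (hhi : μ + r + A < b)
include B hA hADt hlo hhi

/-- The angular section `s ↦ J(ρ, s)` is `C^∞` for `|ρ| < r`. -/
theorem contDiff_levelChartJac_angle {ρ : ℝ} (hρ : |ρ| < r) : ContDiff ℝ ∞ fun s : ℝ => levelChartJac μ K (ρ, s) := by
  have hT : IsOpen ({ρ : ℝ | |ρ| < r} ×ˢ (univ : Set ℝ)) := (isOpen_lt continuous_abs continuous_const).prod isOpen_univ
  refine contDiff_iff_contDiffAt.2 fun s => ?_
  have hmem : (ρ, s) ∈ {ρ : ℝ | |ρ| < r} ×ˢ (univ : Set ℝ) := mk_mem_prod hρ (mem_univ _)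
  have hJ : ContDiffAt ℝ ∞ (levelChartJac μ K) (ρ, s) := (contDiffOn_levelChartJac B hA hADt hlo hhi).contDiffAt (hT.mem_nhds hmem)
  have hc : ContDiffAt ℝ ∞ (fun t : ℝ => ((ρ, t) : ℝ × ℝ)) s := (contDiff_const.prodMk contDiff_id).contDiffAt
  exact hJ.comp s hc

end Rep

section Sizes

variable {K : TrigPolyC4v} {A : ℝ} (hA : ∀ p : Momentum, ∀ j ≤ 2, ‖iteratedFDeriv ℝ j (frameShift K) p‖ ≤ A) (hA20 : A ≤ 1 / 20)
  (hd : klCurveD ≤ (bandBounds (show (-4 : ℝ) < -1.1 by norm_num) (show (-1.1 : ℝ) ≤ -0.1 by norm_num)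
    (show (-0.1 : ℝ) < 0 by norm_num)).Dtmin - 2 * A)
  {μ r : ℝ} (hr : 0 < r) (hlo : (-1.1 : ℝ) < μ - r - A) (hhi : μ + r + A < -0.1)
  {A₃ A₄ : ℝ} (hA₃ : ∀ p : Momentum, ‖iteratedFDeriv ℝ 3 (frameShift K) p‖ ≤ A₃)
  (hA₄ : ∀ p : Momentum, ‖iteratedFDeriv ℝ 4 (frameShift K) p‖ ≤ A₄)
  {K₁ : ℝ} (hK₁ : ∀ p : Momentum, ‖fderiv ℝ (frameLevel μ K) p‖ ≤ K₁)
include hA hA20 hd hr hlo hhi hA₃ hA₄ hK₁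

omit hA20 hA₃ hA₄ hK₁ in
/-- **The base-angle derivative of the pp partner band is the anisotropy defect**: for fixed loop variables `(e, φ)` and configuration `(ρ′, ϑ′)`,
`∂_θ e_K(Φ(0,θ) + Φ(ρ′,ϑ′+θ) − Φ(e,φ+θ)) = De_K(S − Φ(e,φ+θ))[∂_sΦ(0,θ) + ∂_sΦ(ρ′,ϑ′+θ) − ∂_sΦ(e,φ+θ)]`. -/
theorem hasDerivAt_partnerBand_pp_base {ρ' e : ℝ} (hρ' : |ρ'| < r) (he : |e| < r) (ϑ' φ θ : ℝ) :
    HasDerivAt (fun ψ : ℝ => frameLevel μ K (levelPoint μ K 0 ψ + levelPoint μ K ρ' (ϑ' + ψ) - levelPoint μ K e (φ + ψ)))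
      (fderiv ℝ (frameLevel μ K) (levelPoint μ K 0 θ + levelPoint μ K ρ' (ϑ' + θ) - levelPoint μ K e (φ + θ))
        (iteratedDeriv 1 (levelPoint μ K 0) θ + iteratedDeriv 1 (levelPoint μ K ρ') (ϑ' + θ) - iteratedDeriv 1 (levelPoint μ K e) (φ + θ))) θ := by
  have h0 : |(0 : ℝ)| < r := by simpa using hr
  have hF : DifferentiableAt ℝ (frameLevel μ K) (levelPoint μ K 0 θ + levelPoint μ K ρ' (ϑ' + θ) - levelPoint μ K e (φ + θ)) :=
    ((EngineV8.contDiff_frameLevel μ K (n := 1)).differentiable one_ne_zero) _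
  have h1 : HasDerivAt (levelPoint μ K 0) (iteratedDeriv 1 (levelPoint μ K 0) θ) θ := hasDerivAt_levelPoint_angle hA hd hlo hhi h0 θ
  have h2 : HasDerivAt (fun ψ : ℝ => levelPoint μ K ρ' (ϑ' + ψ)) (iteratedDeriv 1 (levelPoint μ K ρ') (ϑ' + θ)) θ :=
    HasDerivAt.comp_const_add ϑ' θ (hasDerivAt_levelPoint_angle hA hd hlo hhi hρ' (ϑ' + θ))
  have h3 : HasDerivAt (fun ψ : ℝ => levelPoint μ K e (φ + ψ)) (iteratedDeriv 1 (levelPoint μ K e) (φ + θ)) θ :=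
    HasDerivAt.comp_const_add φ θ (hasDerivAt_levelPoint_angle hA hd hlo hhi he (φ + θ))
  have hin : HasDerivAt (fun ψ : ℝ => levelPoint μ K 0 ψ + levelPoint μ K ρ' (ϑ' + ψ) - levelPoint μ K e (φ + ψ))
      (iteratedDeriv 1 (levelPoint μ K 0) θ + iteratedDeriv 1 (levelPoint μ K ρ') (ϑ' + θ) - iteratedDeriv 1 (levelPoint μ K e) (φ + θ)) θ := (h1.add h2).sub h3
  exact hF.hasFDerivAt.comp_hasDerivAt θ hin

omit hK₁ in
/-- **The anisotropy defect is bounded** (crudely, by `3K₁D₁`) for every loop point and configuration. -/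
theorem abs_anisotropy_pp_le {ρ' e : ℝ} (hρ' : |ρ'| < r) (he : |e| < r) {K₁ : ℝ} (hK₁ : ∀ p : Momentum, ‖fderiv ℝ (frameLevel μ K) p‖ ≤ K₁) (ϑ' φ θ : ℝ) :
    |fderiv ℝ (frameLevel μ K) (levelPoint μ K 0 θ + levelPoint μ K ρ' (ϑ' + θ) - levelPoint μ K e (φ + θ))
        (iteratedDeriv 1 (levelPoint μ K 0) θ + iteratedDeriv 1 (levelPoint μ K ρ') (ϑ' + θ) - iteratedDeriv 1 (levelPoint μ K e) (φ + θ))| ≤ 3 * K₁ * msD A₃ A₄ 1 := by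
  have h0 : |(0 : ℝ)| < r := by simpa using hr
  have hK₁0 : 0 ≤ K₁ := (norm_nonneg _).trans (hK₁ 0)
  rw [← Real.norm_eq_abs]
  refine ((fderiv ℝ (frameLevel μ K) _).le_opNorm _).trans ?_
  have hv : ‖iteratedDeriv 1 (levelPoint μ K 0) θ + iteratedDeriv 1 (levelPoint μ K ρ') (ϑ' + θ) - iteratedDeriv 1 (levelPoint μ K e) (φ + θ)‖ ≤ 3 * msD A₃ A₄ 1 := by
    have := norm_sub_le (iteratedDeriv 1 (levelPoint μ K 0) θ + iteratedDeriv 1 (levelPoint μ K ρ') (ϑ' + θ)) (iteratedDeriv 1 (levelPoint μ K e) (φ + θ))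
    have := norm_add_le (iteratedDeriv 1 (levelPoint μ K 0) θ) (iteratedDeriv 1 (levelPoint μ K ρ') (ϑ' + θ))
    have := norm_iteratedDeriv_levelPoint_le hA hA20 hd hlo hhi hA₃ hA₄ h0 (i := 1) le_rfl (by norm_num) θ
    have := norm_iteratedDeriv_levelPoint_le hA hA20 hd hlo hhi hA₃ hA₄ hρ' (i := 1) le_rfl (by norm_num) (ϑ' + θ)
    have := norm_iteratedDeriv_levelPoint_le hA hA20 hd hlo hhi hA₃ hA₄ he (i := 1) le_rfl (by norm_num) (φ + θ)
    linarith
  calc ‖fderiv ℝ (frameLevel μ K) (levelPoint μ K 0 θ + levelPoint μ K ρ' (ϑ' + θ) - levelPoint μ K e (φ + θ))‖ *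
        ‖iteratedDeriv 1 (levelPoint μ K 0) θ + iteratedDeriv 1 (levelPoint μ K ρ') (ϑ' + θ) - iteratedDeriv 1 (levelPoint μ K e) (φ + θ)‖ ≤
        K₁ * (3 * msD A₃ A₄ 1) := by gcongr; exact hK₁ _
    _ = 3 * K₁ * msD A₃ A₄ 1 := by ring

/-- **DIFFERENTIATION OF THE CO-MOVING pp LOOP INTEGRAL IN THE BASE ANGLE**: for a smooth `Ψ` with `‖Ψ‖ ≤ M₀`, `‖Ψ′‖ ≤ M₁`, every loop level `|e| < r` and configuration
`|ρ′| < r`, `ϑ′`:  `θ ↦ ∫_{(−π,π)} J(e,φ+θ)·Ψ(ē(e,φ;θ)) dφ` is differentiable with derivative `∫_{(−π,π)} [J(e,φ+θ)·𝒜·Ψ′(ē) + ∂_sJ(e,φ+θ)·Ψ(ē)] dφ`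
(`ē = e_K(Φ(0,θ) + Φ(ρ′,ϑ′+θ) − Φ(e,φ+θ))`, `𝒜` its `θ`-derivative). -/
theorem hasDerivAt_loopIntegral_pp {Ψ : ℝ → ℂ} (hΨ : ContDiff ℝ 2 Ψ) {M₀ M₁ : ℝ} (hΨ0 : ∀ x, ‖Ψ x‖ ≤ M₀) (hΨ1 : ∀ x, ‖deriv Ψ x‖ ≤ M₁)
    {ρ' e : ℝ} (hρ' : |ρ'| < r) (he : |e| < r) (ϑ' θ₀ : ℝ) :
    HasDerivAt (fun θ : ℝ => ∫ φ in Ioo (-π) π,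
        (levelChartJac μ K (e, φ + θ) : ℝ) • Ψ (frameLevel μ K (levelPoint μ K 0 θ + levelPoint μ K ρ' (ϑ' + θ) - levelPoint μ K e (φ + θ))))
      (∫ φ in Ioo (-π) π,
        ((levelChartJac μ K (e, φ + θ₀) : ℝ) •
            ((fderiv ℝ (frameLevel μ K) (levelPoint μ K 0 θ₀ + levelPoint μ K ρ' (ϑ' + θ₀) - levelPoint μ K e (φ + θ₀))
                (iteratedDeriv 1 (levelPoint μ K 0) θ₀ + iteratedDeriv 1 (levelPoint μ K ρ') (ϑ' + θ₀) - iteratedDeriv 1 (levelPoint μ K e) (φ + θ₀))) •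
              deriv Ψ (frameLevel μ K (levelPoint μ K 0 θ₀ + levelPoint μ K ρ' (ϑ' + θ₀) - levelPoint μ K e (φ + θ₀)))) +
          (deriv (fun s : ℝ => levelChartJac μ K (e, s)) (φ + θ₀)) •
            Ψ (frameLevel μ K (levelPoint μ K 0 θ₀ + levelPoint μ K ρ' (ϑ' + θ₀) - levelPoint μ K e (φ + θ₀))))) θ₀ := by
  set B₀ := bandBounds (show (-4 : ℝ) < -1.1 by norm_num) (show (-1.1 : ℝ) ≤ -0.1 by norm_num) (show (-0.1 : ℝ) < 0 by norm_num) with hB₀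
  have hADt : 2 * A < B₀.Dtmin := by have := klCurveD_pos; linarith
  have h0 : |(0 : ℝ)| < r := by simpa using hr
  have he1 := (abs_lt.1 he).1
  have he2 := (abs_lt.1 he).2
  -- the Jacobian data along the loop level `e`
  have hJC : ContDiff ℝ ∞ (fun s : ℝ => levelChartJac μ K (e, s)) := contDiff_levelChartJac_angle B₀ hA hADt hlo hhi he
  have hJ : ∀ s, HasDerivAt (fun s : ℝ => levelChartJac μ K (e, s)) (deriv (fun s : ℝ => levelChartJac μ K (e, s)) s) s := fun s =>
    ((hJC.differentiable (by simp)) s).hasDerivAt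
  have hJ'c : Continuous (deriv fun s : ℝ => levelChartJac μ K (e, s)) := hJC.continuous_deriv (by simp)
  have hJ0 : ∀ s, |levelChartJac μ K (e, s)| ≤ klJacG B₀.Dtmin A A₃ 0 := fun s =>
    abs_levelChartJac_le' B₀ hA hADt (μ := μ) (ρ := e) (by linarith) (by linarith) A₃ s
  have hJ1 : ∀ s, |deriv (fun s : ℝ => levelChartJac μ K (e, s)) s| ≤ klJacG B₀.Dtmin A A₃ 1 := fun s =>
    abs_deriv_levelChartJac_le B₀ hA hADt (μ := μ) (ρ := e) (by linarith) (by linarith) A₃ s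
  -- the propagator data
  have hΨd : ∀ x, HasDerivAt Ψ (deriv Ψ x) x := fun x => ((hΨ.differentiable (by norm_num)) x).hasDerivAt
  have hΨ'c : Continuous (deriv Ψ) := hΨ.continuous_deriv (by norm_num)
  -- the partner-band data
  have hf1 : ContDiff ℝ 1 (frameLevel μ K) := EngineV8.contDiff_frameLevel μ K
  have hlev : ∀ {x : ℝ}, |x| < r → ContDiff ℝ 1 (levelPoint μ K x) := fun hx => contDiff_levelPoint_angle B₀ hA hADt hlo hhi hx
  have hEc : ∀ θ, Continuous fun φ : ℝ => frameLevel μ K (levelPoint μ K 0 θ + levelPoint μ K ρ' (ϑ' + θ) - levelPoint μ K e (φ + θ)) := fun θ =>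
    hf1.continuous.comp (continuous_const.sub ((hlev he).continuous.comp (continuous_id.add continuous_const)))
  have hE'c : ∀ θ, Continuous fun φ : ℝ =>
      fderiv ℝ (frameLevel μ K) (levelPoint μ K 0 θ + levelPoint μ K ρ' (ϑ' + θ) - levelPoint μ K e (φ + θ))
        (iteratedDeriv 1 (levelPoint μ K 0) θ + iteratedDeriv 1 (levelPoint μ K ρ') (ϑ' + θ) - iteratedDeriv 1 (levelPoint μ K e) (φ + θ)) := fun θ => by
    refine Continuous.clm_apply ((hf1.continuous_fderiv one_ne_zero).comp
      (continuous_const.sub ((hlev he).continuous.comp (continuous_id.add continuous_const)))) ?_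
    exact continuous_const.sub (((hlev he).continuous_iteratedDeriv 1 le_rfl).comp (continuous_id.add continuous_const))
  exact hasDerivAt_setIntegral_smul_comp (J := fun s : ℝ => levelChartJac μ K (e, s)) (Ψ := Ψ) (Ψ' := deriv Ψ)
    (E := fun θ φ => frameLevel μ K (levelPoint μ K 0 θ + levelPoint μ K ρ' (ϑ' + θ) - levelPoint μ K e (φ + θ)))
    (E' := fun θ φ => fderiv ℝ (frameLevel μ K) (levelPoint μ K 0 θ + levelPoint μ K ρ' (ϑ' + θ) - levelPoint μ K e (φ + θ))
      (iteratedDeriv 1 (levelPoint μ K 0) θ + iteratedDeriv 1 (levelPoint μ K ρ') (ϑ' + θ) - iteratedDeriv 1 (levelPoint μ K e) (φ + θ)))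
    hJ hJ'c hJ0 hJ1 hΨd hΨ'c hΨ0 hΨ1 (fun θ φ => hasDerivAt_partnerBand_pp_base hA hd hr hlo hhi hρ' he ϑ' φ θ) hEc hE'c
    (fun θ φ => abs_anisotropy_pp_le hA hA20 hd hr hlo hhi hA₃ hA₄ hρ' he hK₁ ϑ' φ θ) θ₀

end Sizes

end Summit.HubbardSuperconductivity.HubbardSuperconductivity.Theorems.C4a

end
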